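import Mathlib
import Literature.Geometry.Lorentzian.KerrSchildCoord
import Literature.Geometry.Lorentzian.KerrConvergence
import Summits.FinalStateConjecture.FinalStateConjecture.Theorems.ClusterCompletenessRecedingDopplerBudgetZones

/-!
# Route ClusterCompleteness — `RecedingDopplerBudget`: bookkeeping of the budget

Helper file for the support item `stmt-FinalStateConjecture-15025`
(`Summit.FinalStateConjecture.FinalStateConjecture.Theses.ClusterCompleteness.RecedingDopplerBudget`).

* `sum_budget`: a finite sequence of nonnegative terms `eᵢ ≤ U` attached to lab times `Tᵢ` that
  grow by at least `g > 0` per step (`T₀ ≥ 0`), and which decays geometrically (`e_{i+1} ≤ θ eᵢ`,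
  `0 ≤ θ < 1`) once `Tᵢ ≥ T⋆`, has sum `≤ U(T⋆/g + 1) + U/(1 − θ)` — at most `T⋆/g + 1` terms before
  the threshold, a geometric series after it;
* the configuration constants of the proof: a positive lower bound of the masses
  (`exists_mass_lb`), a common bound `θ < 1` of the pair Doppler factors `(1 + γ)/(2γ)` and a
  common bound of the pair thresholds (`exists_pair_bounds`).
-/

noncomputable section

open Literature.Geometry.Lorentzian Finset
open scoped InnerProductSpace

namespace Summit.FinalStateConjecture.FinalStateConjecture.Theorems.RecedingDoppler

/-- `∑_{d<K} θ^d ≤ 1/(1 − θ)` for `0 ≤ θ < 1`. [folklore] -/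
theorem geom_sum_le_inv {θ : ℝ} (hθ0 : 0 ≤ θ) (hθ1 : θ < 1) (K : ℕ) :
    ∑ d ∈ range K, θ ^ d ≤ 1 / (1 - θ) := by
  have hne : θ - 1 ≠ 0 := by linarith
  have hne' : 1 - θ ≠ 0 := by linarith
  rw [geom_sum_eq hθ1.ne K, show (θ ^ K - 1) / (θ - 1) = (1 - θ ^ K) / (1 - θ) by
    rw [div_eq_div_iff hne hne']; ring]
  exact div_le_div_of_nonneg_right (by linarith [pow_nonneg hθ0 K]) (by linarith)

/-- **The budget bookkeeping.** Nonnegative terms `eᵢ ≤ U` (`i ≤ n`) with lab times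
`T_{i+1} ≥ Tᵢ + g`, `T₀ ≥ 0`, `g > 0`, decaying by `θ ∈ [0, 1)` after the threshold
(`T⋆ ≤ Tᵢ ⟹ e_{i+1} ≤ θeᵢ`) sum to at most `U(T⋆/g + 1) + U/(1 − θ)`. [folklore] -/
theorem sum_budget {n : ℕ} {e T : ℕ → ℝ} {U g Tst θ : ℝ} (hU : 0 ≤ U) (hg : 0 < g)
    (hθ0 : 0 ≤ θ) (hθ1 : θ < 1) (hTst : 0 ≤ Tst)
    (he0 : ∀ i ≤ n, 0 ≤ e i) (heU : ∀ i ≤ n, e i ≤ U) (hT0 : 0 ≤ T 0)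
    (hgap : ∀ i < n, T i + g ≤ T (i + 1)) (hdec : ∀ i < n, Tst ≤ T i → e (i + 1) ≤ θ * e i) :
    ∑ i ∈ range (n + 1), e i ≤ U * (Tst / g + 1) + U / (1 - θ) := by
  -- `T` dominates `i g` and is monotone
  have hTge : ∀ i ≤ n, (i : ℝ) * g ≤ T i := by
    intro i hi
    induction i with
    | zero => simpa using hT0
    | succ k ih =>
      have := hgap k (Nat.lt_of_succ_le hi)
      have := ih (Nat.le_of_succ_le hi)
      push_cast
      linarith
  have hTmono : ∀ i j, i ≤ j → j ≤ n → T i ≤ T j := by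
    intro i j hij hj
    induction j with
    | zero => simp [Nat.le_zero.mp hij]
    | succ k ih =>
      rcases Nat.lt_or_eq_of_le hij with h | h
      · have := ih (Nat.lt_succ_iff.mp h) (Nat.le_of_succ_le hj)
        have := hgap k (Nat.lt_of_succ_le hj)
        linarith
      · rw [h]
  -- split the sum at the threshold
  rw [← sum_filter_add_sum_filter_not (range (n + 1)) (fun i ↦ T i < Tst)]
  refine add_le_add ?_ ?_
  · -- before the threshold: at most `⌊T⋆/g⌋ + 1` indices
    have hsub : (range (n + 1)).filter (fun i ↦ T i < Tst) ⊆ range (⌊Tst / g⌋₊ + 1) := by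
      intro i hi
      rw [mem_filter, mem_range] at hi
      rw [mem_range, Nat.lt_succ_iff, Nat.le_floor_iff (by positivity)]
      have h1 := hTge i (Nat.lt_succ_iff.mp hi.1)
      rw [le_div_iff₀ hg]
      linarith
    calc ∑ i ∈ (range (n + 1)).filter (fun i ↦ T i < Tst), e i
        ≤ ∑ i ∈ (range (n + 1)).filter (fun i ↦ T i < Tst), U :=
          sum_le_sum fun i hi ↦ heU i (Nat.lt_succ_iff.mp (mem_range.mp (mem_filter.mp hi).1))
      _ = ((range (n + 1)).filter (fun i ↦ T i < Tst)).card * U := by rw [sum_const, nsmul_eq_mul]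
      _ ≤ (range (⌊Tst / g⌋₊ + 1)).card * U :=
          mul_le_mul_of_nonneg_right (Nat.cast_le.2 (card_le_card hsub)) hU
      _ ≤ U * (Tst / g + 1) := by
          rw [card_range, Nat.cast_succ, mul_comm]
          refine mul_le_mul_of_nonneg_left ?_ hU
          linarith [Nat.floor_le (show 0 ≤ Tst / g by positivity)]
  · -- after the threshold: geometric decay from the first such index
    by_cases hB : ∃ i, i ≤ n ∧ Tst ≤ T i
    · set i₀ := Nat.find hB with hi₀
      obtain ⟨hi₀n, hi₀T⟩ := Nat.find_spec hB
      have hmin : ∀ i, i ≤ n → Tst ≤ T i → i₀ ≤ i := fun i hi hT ↦ Nat.find_min' hB ⟨hi, hT⟩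
      -- the filter is contained in `Ico i₀ (n + 1)`
      have hsub : (range (n + 1)).filter (fun i ↦ ¬ T i < Tst) ⊆ Ico i₀ (n + 1) := by
        intro i hi
        rw [mem_filter, mem_range, not_lt] at hi
        exact mem_Ico.2 ⟨hmin i (Nat.lt_succ_iff.mp hi.1) hi.2, hi.1⟩
      -- geometric decay from `i₀`
      have hdecay : ∀ d, i₀ + d ≤ n → e (i₀ + d) ≤ U * θ ^ d := by
        intro d
        induction d with
        | zero => intro h; simpa using heU i₀ h
        | succ d ih =>
          intro h
          have hd : i₀ + d ≤ n := by omega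
          have h1 := ih hd
          have hT : Tst ≤ T (i₀ + d) := hi₀T.trans (hTmono i₀ (i₀ + d) (by omega) hd)
          have h2 := hdec (i₀ + d) (by omega) hT
          rw [show i₀ + (d + 1) = i₀ + d + 1 by omega]
          calc e (i₀ + d + 1) ≤ θ * e (i₀ + d) := h2
            _ ≤ θ * (U * θ ^ d) := mul_le_mul_of_nonneg_left h1 hθ0
            _ = U * θ ^ (d + 1) := by ring
      calc ∑ i ∈ (range (n + 1)).filter (fun i ↦ ¬ T i < Tst), e i
          ≤ ∑ i ∈ Ico i₀ (n + 1), e i :=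
            sum_le_sum_of_subset_of_nonneg hsub fun i hi _ ↦
              he0 i (Nat.lt_succ_iff.mp (mem_Ico.mp hi).2)
        _ = ∑ d ∈ range (n + 1 - i₀), e (i₀ + d) := sum_Ico_eq_sum_range _ _ _
        _ ≤ ∑ d ∈ range (n + 1 - i₀), U * θ ^ d :=
            sum_le_sum fun d hd ↦ hdecay d (by have := mem_range.mp hd; omega)
        _ = U * ∑ d ∈ range (n + 1 - i₀), θ ^ d := by rw [mul_sum]
        _ ≤ U * (1 / (1 - θ)) := mul_le_mul_of_nonneg_left (geom_sum_le_inv hθ0 hθ1 _) hU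
        _ = U / (1 - θ) := by ring
    · have hempty : (range (n + 1)).filter (fun i ↦ ¬ T i < Tst) = ∅ := by
        rw [filter_eq_empty_iff]
        intro i hi hneg
        exact hB ⟨i, Nat.lt_succ_iff.mp (mem_range.mp hi), not_lt.mp hneg⟩
      rw [hempty, sum_empty]
      exact div_nonneg hU (by linarith)

/-! ### Configuration constants -/

/-- A positive lower bound of finitely many positive masses. [folklore] -/
theorem exists_mass_lb {N : ℕ} {M : Fin N → ℝ} (hM : ∀ i, 0 < M i) :
    ∃ m : ℝ, 0 < m ∧ ∀ i, m ≤ M i := by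
  by_cases hN : (Finset.univ : Finset (Fin N)).Nonempty
  · obtain ⟨i₀, -, hi₀⟩ := Finset.exists_min_image Finset.univ M hN
    exact ⟨M i₀, hM i₀, fun i ↦ hi₀ i (Finset.mem_univ i)⟩
  · refine ⟨1, one_pos, fun i ↦ ?_⟩
    exact absurd ⟨i, Finset.mem_univ i⟩ hN

/-- A common upper bound of finitely many reals indexed by ordered pairs, with a floor. [folklore] -/
theorem exists_pair_le {N : ℕ} (f : Fin N → Fin N → ℝ) (b : ℝ) :
    ∃ T : ℝ, b ≤ T ∧ ∀ j k, f j k ≤ T := by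
  obtain ⟨T, hT⟩ := Finite.exists_le (fun jk : Fin N × Fin N ↦ f jk.1 jk.2)
  exact ⟨max T b, le_max_right _ _, fun j k ↦ (hT (j, k)).trans (le_max_left _ _)⟩

/-- **A common Doppler factor `θ < 1`.** For a configuration with pairwise distinct lab velocities
and slow holes, the pair factors `(1 + γ_{jk})/(2γ_{jk})`, `γ_{jk} = −η(u_k, u_j) > 1`, have a
common bound `θ ∈ [0, 1)`. [folklore] -/
theorem exists_theta {N : ℕ} {Λ : Fin N → lorentzGroup} {p : Fin N → E3} {u : Fin N → E4}
    (hu : ∀ i, u i = (Λ i : E4 ≃L[ℝ] E4) (E4.basisVector 0))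
    (hv : ∀ i, 0 < u i 0 ∧ ‖E4.spatial (u i)‖ ≤ 1 / 10 * u i 0)
    (hsep : ∀ i j, i ≠ j →
      0 < ⟪p i - p j, (u i 0)⁻¹ • E4.spatial (u i) - (u j 0)⁻¹ • E4.spatial (u j)⟫_ℝ) :
    ∃ θ : ℝ, 0 ≤ θ ∧ θ < 1 ∧ ∀ j k, j ≠ k →
      (1 + -Minkowski.bilin (u k) (u j)) / (2 * -Minkowski.bilin (u k) (u j)) ≤ θ := by
  classical
  set f : Fin N × Fin N → ℝ := fun jk ↦ if jk.1 = jk.2 then 0 else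
    (1 + -Minkowski.bilin (u jk.2) (u jk.1)) / (2 * -Minkowski.bilin (u jk.2) (u jk.1)) with hf
  have hflt : ∀ jk, 0 ≤ f jk ∧ f jk < 1 := by
    rintro ⟨j, k⟩
    by_cases hjk : j = k
    · simp [hf, hjk]
    · have hγ : 1 < -Minkowski.bilin (u k) (u j) :=
        one_lt_neg_minkowski_u (Λ k) (Λ j) (hu k) (hu j) (hv k) (hv j) fun h ↦
          (hsep j k hjk).ne' (by rw [h, sub_self, inner_zero_right])
      simp only [hf, hjk, if_false]
      constructor
      · exact div_nonneg (by linarith) (by linarith)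
      · rw [div_lt_one (by linarith)]; linarith
  by_cases hN : (Finset.univ : Finset (Fin N × Fin N)).Nonempty
  · obtain ⟨jk₀, -, hmax⟩ := Finset.exists_max_image Finset.univ f hN
    refine ⟨f jk₀, (hflt jk₀).1, (hflt jk₀).2, fun j k hjk ↦ ?_⟩
    have := hmax (j, k) (Finset.mem_univ _)
    simp only [hf, hjk, if_false] at this ⊢
    exact this
  · refine ⟨0, le_rfl, one_pos, fun j k _ ↦ ?_⟩
    exact absurd ⟨(j, k), Finset.mem_univ _⟩ hN

end Summit.FinalStateConjecture.FinalStateConjecture.Theorems.RecedingDoppler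

end
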